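import Mathlib
import Summits.NavierStokesRegularity.NavierStokesRegularity.Theorems.EulerZoomLiouvillePowerGaugeEulerLiouvilleSwirlCapacityEndgamePow
import HarnessLib

/-!
# Crux `EulerZoomLiouville.PowerGaugeEulerLiouville` (stmt-NavierStokesRegularity-19832), line `swirl-capacity`:
# THE THREE DOORS — square-log (rev-2 stub D3sq `stub_swirlEndgameSq`, BY NAME), power-lossy (D3_pow), log-sharp, into ONE endgame

Route №10 `EulerZoomLiouville` (NavierStokesRegularity), crux E.  Line `swirl-capacity` (ideator ns-idea-11 g3;
`Cruxes/PowerGaugeEulerLiouville/Lines/swirl_capacity.lean`, rev 2); part 3 of the power-tolerant endgame (director-ns #185 (2)).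
Parts 1–2 (`…SwirlCapacityPowerFloors`, `…SwirlCapacityEndgamePow`) show that every typed lever of the line yields the power swirl floors
`SwirlPow_η` for all `η ∈ (0,1]` and that those floors run the endgame.  This file only composes, in the line's binder shapes (the Cruxes
file is not importable, so `InClass`, `IsAxiDriftingWith`, `HasPastSwirl`, `SwirlBlobsPersist`, `VanishesAE`, `driftRadius`,
`AxisCapacityFloorSq`, `AxisCapacityFloor` appear δ-unfolded; the skeleton fills its stubs by `exact`):

* **`swirlEndgameSq`** — `Sig.stub_swirlEndgameSq` (rev 2, D3sq) UNFOLDED: the square-log axis floor `AxisCapacityFloorSq` ⇒ the endgame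
  (`axisCapacityFloorPow_of_axisCapacityFloorSq` ∘ `swirlCapacityFloorPow_of_axisCapacityFloorPow` ∘
  `vanishesAE_of_swirlCapacityFloorPow_of_swirlBlobsPersist`);
* **`swirlEndgamePow`** — the endgame from the power-lossy axis lever in its announced binder shape
  `∀ q ≥ 2, ∃ K > 0, … ofReal (K γ₀² (V/A³)^{2/q} / A) ≤ ∫⁻_{B(3A)} ‖∇f‖²/r²` (ns-cas-k2, `AxisCapacityFloorPow`; `η = 2/q` sweeps `(0,1]`);
* `swirlEndgameLog` — the endgame from the log-sharp lever `AxisCapacityFloor` through the same door (a second proof of the landed composition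
  D2 → D2′ → D3, recorded so that all three levers visibly feed one endgame).

WHAT THIS IS NOT: not NS, not the crux — a helper `--supports` stmt-19832 on the line `swirl-capacity`; the levers D2 / D2sq / D2_pow and the
residue D4 stay OPEN / with their owners; no summit statement is proved here. [cite: MajdaBertozziCUP2002, §2.3.3 (2.67); CaffarelliKohnNirenberg1982, §2]
-/

noncomputable section

-- flat `Theorems/<Route><Decl>…` files of one crux share the namespace of the crux (tree convention)
set_option linter.dupNamespace false

open MeasureTheory Set Filter Topology Metric Function
open scoped NNReal ENNReal

namespace Summit.NavierStokesRegularity.NavierStokesRegularity.Theorems.PowerGaugeEulerLiouville.SwirlCapacity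

open Literature.Analysis Literature.Analysis.FluidPDE
open Summit.NavierStokesRegularity.NavierStokesRegularity.Theorems.PowerGaugeEulerLiouville.SwirlfreeLedger

/-! ### The three doors: square-log (rev 2 D3sq, by name), power-lossy lever, log-sharp lever -/

/-- **D3sq `stub_swirlEndgameSq` of the line `swirl-capacity` (rev 2), signature unfolded**: the SQUARE-LOG axis capacity floor
(`AxisCapacityFloorSq`: `∫_{B(3A)} ‖∇f‖²/r² ≥ K γ₀² / (A (1 + log⁺(A³/V))²)` for axisymmetric `C¹` scalars vanishing on the axis) already
runs the whole endgame: square-log ⇒ power axis floors (`axisCapacityFloorPow_of_axisCapacityFloorSq`) ⇒ power swirl floors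
(`swirlCapacityFloorPow_of_axisCapacityFloorPow`) ⇒ `vanishesAE_of_swirlCapacityFloorPow_of_swirlBlobsPersist`.
[cite: MajdaBertozziCUP2002, §2.3.3 (2.67); CaffarelliKohnNirenberg1982, §2] -/
theorem swirlEndgameSq :
    (∃ K : ℝ, 0 < K ∧ ∀ (f : EuclideanSpace ℝ (Fin 3) → ℝ) (T : Set (EuclideanSpace ℝ (Fin 3))) (A V γ₀ : ℝ),
      ContDiff ℝ 1 f → IsAxisymmetricScalar f →
      (∀ x : EuclideanSpace ℝ (Fin 3), cylRadius x = 0 → f x = 0) → 0 < A → 0 < V → 0 < γ₀ → MeasurableSet T →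
      T ⊆ ball (0 : EuclideanSpace ℝ (Fin 3)) A →
      ENNReal.ofReal V ≤ volume T → (∀ x ∈ T, γ₀ ≤ f x) →
        ENNReal.ofReal (K * γ₀ ^ 2 / (A * (1 + max 0 (Real.log (A ^ 3 / V))) ^ 2)) ≤
          ∫⁻ x in ball (0 : EuclideanSpace ℝ (Fin 3)) (3 * A), ENNReal.ofReal (‖fderiv ℝ f x‖ ^ 2 / cylRadius x ^ 2)) →
    ∀ ρ : ℝ, 0 < ρ → ρ ≤ 1 / 2 →
      ∀ (u : ℝ → EuclideanSpace ℝ (Fin 3) → EuclideanSpace ℝ (Fin 3)) (p : ℝ → EuclideanSpace ℝ (Fin 3) → ℝ)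
        (H : ℝ → EuclideanSpace ℝ (Fin 3) → EuclideanSpace ℝ (Fin 3) →L[ℝ] EuclideanSpace ℝ (Fin 3)) (c : ℝ≥0),
        (IsSuitableWeakSolutionOn (slab (EuclideanSpace ℝ (Fin 3)) (Set.Iio 0) isOpen_Iio) 0 0 u p ∧
            HasWeakSpatialGradientOn (slab (EuclideanSpace ℝ (Fin 3)) (Set.Iio 0) isOpen_Iio) u H ∧
            (∀ a : ℝ, 0 < a →
              ENNReal.ofReal (a ^ (2 * ρ)) * cknA a (0 : ℝ × EuclideanSpace ℝ (Fin 3)) u +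
                    ENNReal.ofReal (a ^ ρ) * cknE a (0 : ℝ × EuclideanSpace ℝ (Fin 3)) H +
                  ENNReal.ofReal (a ^ (2 * ρ)) * cknD a (0 : ℝ × EuclideanSpace ℝ (Fin 3)) p ≤ (c : ℝ≥0∞))) →
          ∀ M κ : ℝ, (1 - ρ) / (2 - ρ) < κ →
            (IsClassicalEulerSolutionOn (Set.Iio 0) 0 u p ∧
                (∀ τ : ℝ, τ < 0 → IsAxisymmetric (u τ) ∧ IsAxisymmetricScalar (p τ)) ∧
                0 ≤ M ∧ κ < 1 ∧ ∀ τ : ℝ, τ < 0 → ∀ x : EuclideanSpace ℝ (Fin 3), ‖u τ x‖ ≤ M * (-τ) ^ (-κ)) →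
            (∃ τ₀ : ℝ, τ₀ < 0 ∧ ∃ x : EuclideanSpace ℝ (Fin 3), swirl (u τ₀) x ≠ 0) →
            (∀ t₀ : ℝ, t₀ < 0 → ∀ (x₀ : EuclideanSpace ℝ (Fin 3)) (δ γ₀ : ℝ), 0 < δ → δ < cylRadius x₀ →
                (∀ x ∈ ball x₀ δ, γ₀ ≤ |swirl (u t₀) x|) →
                ∀ t₁ : ℝ, t₁ < t₀ →
                  ∃ T : Set (EuclideanSpace ℝ (Fin 3)), MeasurableSet T ∧
                    T ⊆ ball (0 : EuclideanSpace ℝ (Fin 3)) (‖x₀‖ + δ + M / (1 - κ) * ((-t₁) ^ (1 - κ) - (-t₀) ^ (1 - κ))) ∧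
                    (∀ x ∈ T, γ₀ ≤ |swirl (u t₁) x|) ∧ volume (ball x₀ δ) ≤ volume T) →
              Function.uncurry u =ᵐ[volume.restrict (Set.Iio (0 : ℝ) ×ˢ (Set.univ : Set (EuclideanSpace ℝ (Fin 3))))] 0 :=
  fun hsq => vanishesAE_of_swirlCapacityFloorPow_of_swirlBlobsPersist
    (swirlCapacityFloorPow_of_axisCapacityFloorPow (axisCapacityFloorPow_of_axisCapacityFloorSq hsq))

/-- **The endgame from the power-lossy axis lever** (critic V29 price P3: `∀ q ≥ 2, ∃ K_q > 0, ∫_{B(3A)} ‖∇f‖²/r² ≥ K_q γ₀² (V/A³)^{2/q} / A`,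
the form in which the lever is being landed as `…SwirlCapacityAxisFloorPlanar` / `…AxisFloorMeridional` / `…AxisFloor`): `η = 2/q` runs
through `(0,1]` as `q` runs through `[2,∞)`, so the power floors hold and the endgame applies.
[cite: MajdaBertozziCUP2002, §2.3.3 (2.67); CaffarelliKohnNirenberg1982, §2] -/
theorem swirlEndgamePow :
    (∀ q : ℝ, 2 ≤ q → ∃ K : ℝ, 0 < K ∧ ∀ (f : EuclideanSpace ℝ (Fin 3) → ℝ) (T : Set (EuclideanSpace ℝ (Fin 3))) (A V γ₀ : ℝ),
      ContDiff ℝ 1 f → IsAxisymmetricScalar f →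
      (∀ x : EuclideanSpace ℝ (Fin 3), cylRadius x = 0 → f x = 0) → 0 < A → 0 < V → 0 < γ₀ → MeasurableSet T →
      T ⊆ ball (0 : EuclideanSpace ℝ (Fin 3)) A →
      ENNReal.ofReal V ≤ volume T → (∀ x ∈ T, γ₀ ≤ f x) →
        ENNReal.ofReal (K * γ₀ ^ 2 * (V / A ^ 3) ^ (2 / q) / A) ≤
          ∫⁻ x in ball (0 : EuclideanSpace ℝ (Fin 3)) (3 * A), ENNReal.ofReal (‖fderiv ℝ f x‖ ^ 2 / cylRadius x ^ 2)) →
    ∀ ρ : ℝ, 0 < ρ → ρ ≤ 1 / 2 →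
      ∀ (u : ℝ → EuclideanSpace ℝ (Fin 3) → EuclideanSpace ℝ (Fin 3)) (p : ℝ → EuclideanSpace ℝ (Fin 3) → ℝ)
        (H : ℝ → EuclideanSpace ℝ (Fin 3) → EuclideanSpace ℝ (Fin 3) →L[ℝ] EuclideanSpace ℝ (Fin 3)) (c : ℝ≥0),
        (IsSuitableWeakSolutionOn (slab (EuclideanSpace ℝ (Fin 3)) (Set.Iio 0) isOpen_Iio) 0 0 u p ∧
            HasWeakSpatialGradientOn (slab (EuclideanSpace ℝ (Fin 3)) (Set.Iio 0) isOpen_Iio) u H ∧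
            (∀ a : ℝ, 0 < a →
              ENNReal.ofReal (a ^ (2 * ρ)) * cknA a (0 : ℝ × EuclideanSpace ℝ (Fin 3)) u +
                    ENNReal.ofReal (a ^ ρ) * cknE a (0 : ℝ × EuclideanSpace ℝ (Fin 3)) H +
                  ENNReal.ofReal (a ^ (2 * ρ)) * cknD a (0 : ℝ × EuclideanSpace ℝ (Fin 3)) p ≤ (c : ℝ≥0∞))) →
          ∀ M κ : ℝ, (1 - ρ) / (2 - ρ) < κ →
            (IsClassicalEulerSolutionOn (Set.Iio 0) 0 u p ∧
                (∀ τ : ℝ, τ < 0 → IsAxisymmetric (u τ) ∧ IsAxisymmetricScalar (p τ)) ∧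
                0 ≤ M ∧ κ < 1 ∧ ∀ τ : ℝ, τ < 0 → ∀ x : EuclideanSpace ℝ (Fin 3), ‖u τ x‖ ≤ M * (-τ) ^ (-κ)) →
            (∃ τ₀ : ℝ, τ₀ < 0 ∧ ∃ x : EuclideanSpace ℝ (Fin 3), swirl (u τ₀) x ≠ 0) →
            (∀ t₀ : ℝ, t₀ < 0 → ∀ (x₀ : EuclideanSpace ℝ (Fin 3)) (δ γ₀ : ℝ), 0 < δ → δ < cylRadius x₀ →
                (∀ x ∈ ball x₀ δ, γ₀ ≤ |swirl (u t₀) x|) →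
                ∀ t₁ : ℝ, t₁ < t₀ →
                  ∃ T : Set (EuclideanSpace ℝ (Fin 3)), MeasurableSet T ∧
                    T ⊆ ball (0 : EuclideanSpace ℝ (Fin 3)) (‖x₀‖ + δ + M / (1 - κ) * ((-t₁) ^ (1 - κ) - (-t₀) ^ (1 - κ))) ∧
                    (∀ x ∈ T, γ₀ ≤ |swirl (u t₁) x|) ∧ volume (ball x₀ δ) ≤ volume T) →
              Function.uncurry u =ᵐ[volume.restrict (Set.Iio (0 : ℝ) ×ˢ (Set.univ : Set (EuclideanSpace ℝ (Fin 3))))] 0 := by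
  intro hq
  refine vanishesAE_of_swirlCapacityFloorPow_of_swirlBlobsPersist (swirlCapacityFloorPow_of_axisCapacityFloorPow ?_)
  intro η hη hη1
  -- `q = 2/η ≥ 2` and `2/q = η`
  obtain ⟨K, hK, hfloor⟩ := hq (2 / η) (by rw [le_div_iff₀ hη]; linarith)
  refine ⟨K, hK, ?_⟩
  intro f T A V γ₀ hf hax h0 hA hV hγ hT hTA hvol hlev
  have e : 2 / (2 / η) = η := by field_simp
  have h := hfloor f T A V γ₀ hf hax h0 hA hV hγ hT hTA hvol hlev
  rwa [e] at h

/-- **The endgame from the log-sharp lever, through the same door** (a second proof of the landed D3 composition `D2 → D2′ → D3`,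
recorded so that all three typed levers of the line visibly feed ONE endgame). [cite: MajdaBertozziCUP2002, §2.3.3 (2.67)] -/
theorem swirlEndgameLog :
    (∃ K : ℝ, 0 < K ∧ ∀ (f : EuclideanSpace ℝ (Fin 3) → ℝ) (T : Set (EuclideanSpace ℝ (Fin 3))) (A V γ₀ : ℝ),
      ContDiff ℝ 1 f → IsAxisymmetricScalar f →
      (∀ x : EuclideanSpace ℝ (Fin 3), cylRadius x = 0 → f x = 0) → 0 < A → 0 < V → 0 < γ₀ → MeasurableSet T →
      T ⊆ ball (0 : EuclideanSpace ℝ (Fin 3)) A →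
      ENNReal.ofReal V ≤ volume T → (∀ x ∈ T, γ₀ ≤ f x) →
        ENNReal.ofReal (K * γ₀ ^ 2 / (A * (1 + max 0 (Real.log (A ^ 3 / V))))) ≤
          ∫⁻ x in ball (0 : EuclideanSpace ℝ (Fin 3)) (3 * A), ENNReal.ofReal (‖fderiv ℝ f x‖ ^ 2 / cylRadius x ^ 2)) →
    ∀ ρ : ℝ, 0 < ρ → ρ ≤ 1 / 2 →
      ∀ (u : ℝ → EuclideanSpace ℝ (Fin 3) → EuclideanSpace ℝ (Fin 3)) (p : ℝ → EuclideanSpace ℝ (Fin 3) → ℝ)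
        (H : ℝ → EuclideanSpace ℝ (Fin 3) → EuclideanSpace ℝ (Fin 3) →L[ℝ] EuclideanSpace ℝ (Fin 3)) (c : ℝ≥0),
        (IsSuitableWeakSolutionOn (slab (EuclideanSpace ℝ (Fin 3)) (Set.Iio 0) isOpen_Iio) 0 0 u p ∧
            HasWeakSpatialGradientOn (slab (EuclideanSpace ℝ (Fin 3)) (Set.Iio 0) isOpen_Iio) u H ∧
            (∀ a : ℝ, 0 < a →
              ENNReal.ofReal (a ^ (2 * ρ)) * cknA a (0 : ℝ × EuclideanSpace ℝ (Fin 3)) u +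
                    ENNReal.ofReal (a ^ ρ) * cknE a (0 : ℝ × EuclideanSpace ℝ (Fin 3)) H +
                  ENNReal.ofReal (a ^ (2 * ρ)) * cknD a (0 : ℝ × EuclideanSpace ℝ (Fin 3)) p ≤ (c : ℝ≥0∞))) →
          ∀ M κ : ℝ, (1 - ρ) / (2 - ρ) < κ →
            (IsClassicalEulerSolutionOn (Set.Iio 0) 0 u p ∧
                (∀ τ : ℝ, τ < 0 → IsAxisymmetric (u τ) ∧ IsAxisymmetricScalar (p τ)) ∧
                0 ≤ M ∧ κ < 1 ∧ ∀ τ : ℝ, τ < 0 → ∀ x : EuclideanSpace ℝ (Fin 3), ‖u τ x‖ ≤ M * (-τ) ^ (-κ)) →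
            (∃ τ₀ : ℝ, τ₀ < 0 ∧ ∃ x : EuclideanSpace ℝ (Fin 3), swirl (u τ₀) x ≠ 0) →
            (∀ t₀ : ℝ, t₀ < 0 → ∀ (x₀ : EuclideanSpace ℝ (Fin 3)) (δ γ₀ : ℝ), 0 < δ → δ < cylRadius x₀ →
                (∀ x ∈ ball x₀ δ, γ₀ ≤ |swirl (u t₀) x|) →
                ∀ t₁ : ℝ, t₁ < t₀ →
                  ∃ T : Set (EuclideanSpace ℝ (Fin 3)), MeasurableSet T ∧
                    T ⊆ ball (0 : EuclideanSpace ℝ (Fin 3)) (‖x₀‖ + δ + M / (1 - κ) * ((-t₁) ^ (1 - κ) - (-t₀) ^ (1 - κ))) ∧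
                    (∀ x ∈ T, γ₀ ≤ |swirl (u t₁) x|) ∧ volume (ball x₀ δ) ≤ volume T) →
              Function.uncurry u =ᵐ[volume.restrict (Set.Iio (0 : ℝ) ×ˢ (Set.univ : Set (EuclideanSpace ℝ (Fin 3))))] 0 :=
  fun hlog => vanishesAE_of_swirlCapacityFloorPow_of_swirlBlobsPersist
    (swirlCapacityFloorPow_of_axisCapacityFloorPow (axisCapacityFloorPow_of_axisCapacityFloor hlog))

end Summit.NavierStokesRegularity.NavierStokesRegularity.Theorems.PowerGaugeEulerLiouville.SwirlCapacity

end
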